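import Mathlib
import HarnessLib
import Literature.Geometry.DiscreteGeometry.BondGraph
import Literature.Geometry.DiscreteGeometry.KissingPatterns
import Literature.Geometry.DiscreteGeometry.KissingRigidity
import Summits.AtomisticToContinuum.Crystallization.Theorems.PricedLinkCensusSoftLayerPropagationStubChartAssembly
import Summits.AtomisticToContinuum.Crystallization.Theorems.PricedLinkCensusSoftLayerPropagationStubShadowTransition
import Summits.AtomisticToContinuum.Crystallization.Theorems.PricedLinkCensusSoftLayerPropagationStubDevelopFrames

/-!
# The triangle rule of the shadow development (crux `SoftLayerPropagation`, line `Sketch`)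

Route `PricedLinkCensus`, crux `SoftLayerPropagation` (stmt-AtomisticToContinuum-14233), line
`Sketch`, helper file for the stub `stub_develop` (development of the exact shadow crystal on a
graph ball): registered sub-goal `develop_triangle`.

Charts are now FUNCTIONS of the site (`Pc v`, `Ac v`, `mc v`: pattern, isometry, labels), frames
are functions `D v`, `Q v`; "`v` is charted" and "the frames at `j ~ k` are compatible" are the
conjunctions written out in the statements (no new definitions), exactly as in
`…StubDevelopFrames.lean`.

* `develop_transition_oriented`: if the two charts of a bond `j ~ k` give every contact
  TETRAHEDRON `{j, k, a, b}` the same handedness (the signed volumes `det [ℓ_j k, ℓ_j a, ℓ_j b]`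
  and `det [ℓ_k j, ℓ_k a, ℓ_k b]` of the label triples are opposite — hypothesis `HO`, a metric
  fact about charts of one handedness, NOT proved here), then the transition isometry `L` of
  `shadow_transition` preserves signed volumes (`det [L x, L y, L z] = det [x, y, z]`).
* `develop_triangle` (registered): for a bond triangle `c ~ u ~ t ~ c` of charted sites with the
  handedness hypothesis on its three bonds, compatibility of the frames at `(c, u)` and at
  `(c, t)` implies compatibility at `(u, t)`.  Proof: by the frame equation the claim is the
  COCYCLE IDENTITY `L_ct = L_ut ∘ L_cu` of the three transition isometries; both sides agree on
  the labels of `u` and `t` at `c` (two touching unit vectors) and both preserve signed volumes,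
  and a volume-preserving isometry of `ℝ³` fixing two independent vectors is the identity
  (`eq_of_eq_on_pair_of_det`).  A contact triangle need NOT lie in a contact tetrahedron (three of
  the six equatorial triangles at an HCP site do not), which is why the orientation enters.

All `[folklore]` (holonomy of a flat discrete `O(3)`-connection around a triangle; linear algebra
of `ℝ³`).
-/

noncomputable section

namespace Summit.AtomisticToContinuum.Crystallization.Theorems

open Literature.Geometry.DiscreteGeometry
open RealInnerProductSpace
open Matrix

/-! ### Signed volumes of triples under linear maps of `ℝ³` -/

/-- A linear map of `ℝ³` multiplies the signed volume `det [x, y, z]` of every triple by one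
scalar (its determinant). [folklore] -/
theorem exists_det_map_eq_mul (L : EuclideanSpace ℝ (Fin 3) →ₗ[ℝ] EuclideanSpace ℝ (Fin 3)) :
    ∃ δ : ℝ, ∀ x y z : EuclideanSpace ℝ (Fin 3),
      Matrix.det ![WithLp.ofLp (L x), WithLp.ofLp (L y), WithLp.ofLp (L z)] =
        δ * Matrix.det ![WithLp.ofLp x, WithLp.ofLp y, WithLp.ofLp z] := by
  set e := WithLp.linearEquiv 2 ℝ (Fin 3 → ℝ) with he
  set Lf : (Fin 3 → ℝ) →ₗ[ℝ] (Fin 3 → ℝ) := e.toLinearMap ∘ₗ L ∘ₗ e.symm.toLinearMap with hLf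
  set M := LinearMap.toMatrix' Lf with hM
  have hmul : ∀ x : EuclideanSpace ℝ (Fin 3), WithLp.ofLp (L x) = M *ᵥ (WithLp.ofLp x) := by
    intro x
    rw [hM, LinearMap.toMatrix'_mulVec]
    simp [hLf, he]
  refine ⟨M.det, fun x y z => ?_⟩
  have key : (Matrix.of ![WithLp.ofLp (L x), WithLp.ofLp (L y), WithLp.ofLp (L z)] :
      Matrix (Fin 3) (Fin 3) ℝ) = Matrix.of ![WithLp.ofLp x, WithLp.ofLp y, WithLp.ofLp z] * Mᵀ := by
    ext i j
    rw [Matrix.mul_apply]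
    simp only [Matrix.transpose_apply, Matrix.of_apply]
    fin_cases i <;> simp [hmul, Matrix.mulVec, dotProduct, Fin.sum_univ_three, mul_comm]
  have h := congrArg Matrix.det key
  rw [Matrix.det_mul, Matrix.det_transpose, mul_comm] at h
  exact h

/-- A triple of `ℝ³` with vanishing signed volume is linearly dependent (explicit relation).
[folklore] -/
theorem exists_rel_of_det_eq_zero {a b c : EuclideanSpace ℝ (Fin 3)}
    (h : Matrix.det ![WithLp.ofLp a, WithLp.ofLp b, WithLp.ofLp c] = 0) :
    ∃ v : Fin 3 → ℝ, v ≠ 0 ∧ v 0 • a + v 1 • b + v 2 • c = 0 := by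
  obtain ⟨v, hv, hv0⟩ := Matrix.exists_vecMul_eq_zero_iff.2 h
  refine ⟨v, hv, ?_⟩
  apply (WithLp.linearEquiv 2 ℝ (Fin 3 → ℝ)).injective
  have : v ᵥ* ![WithLp.ofLp a, WithLp.ofLp b, WithLp.ofLp c] =
      v 0 • WithLp.ofLp a + v 1 • WithLp.ofLp b + v 2 • WithLp.ofLp c := by
    ext j
    simp [Matrix.vecMul, dotProduct, Fin.sum_univ_three]
  rw [this] at hv0
  simpa using hv0

/-- Two touching unit vectors are linearly independent. [folklore] -/
theorem linearIndependent_pair_of_dist_eq_one {a b : EuclideanSpace ℝ (Fin 3)} (ha : ‖a‖ = 1)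
    (hb : ‖b‖ = 1) (hab : dist a b = 1) : LinearIndependent ℝ ![a, b] := by
  have iab := inner_eq_half_of_dist_eq_one ha hb hab
  have iaa : ⟪a, a⟫ = 1 := by rw [real_inner_self_eq_norm_sq, ha]; norm_num
  have ibb : ⟪b, b⟫ = 1 := by rw [real_inner_self_eq_norm_sq, hb]; norm_num
  refine LinearIndependent.pair_iff.2 fun s t hst => ?_
  have h1 := congrArg (fun z => ⟪z, a⟫) hst
  have h2 := congrArg (fun z => ⟪z, b⟫) hst
  simp only [inner_add_left, real_inner_smul_left, iaa, ibb, iab, real_inner_comm a b,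
    inner_zero_left] at h1 h2
  constructor <;> linarith

/-- Three pairwise touching unit vectors have non-zero signed volume. [folklore] -/
theorem det_ne_zero_of_unit_triangle {a b c : EuclideanSpace ℝ (Fin 3)} (ha : ‖a‖ = 1)
    (hb : ‖b‖ = 1) (hc : ‖c‖ = 1) (hab : dist a b = 1) (hac : dist a c = 1) (hbc : dist b c = 1) :
    Matrix.det ![WithLp.ofLp a, WithLp.ofLp b, WithLp.ofLp c] ≠ 0 := by
  intro h
  obtain ⟨v, hv, hrel⟩ := exists_rel_of_det_eq_zero h
  have hli : LinearIndependent ℝ ![a, b, c] := by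
    refine linearIndependent_of_unit_triangle ?_ ?_
    · intro i
      fin_cases i
      · show ⟪a, a⟫ = 1
        rw [real_inner_self_eq_norm_sq, ha]; norm_num
      · show ⟪b, b⟫ = 1
        rw [real_inner_self_eq_norm_sq, hb]; norm_num
      · show ⟪c, c⟫ = 1
        rw [real_inner_self_eq_norm_sq, hc]; norm_num
    · intro i j hij
      have iab := inner_eq_half_of_dist_eq_one ha hb hab
      have iac := inner_eq_half_of_dist_eq_one ha hc hac
      have ibc := inner_eq_half_of_dist_eq_one hb hc hbc
      fin_cases i <;> fin_cases j
      all_goals (first | exact absurd rfl hij | skip)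
      · simpa using iab
      · simpa using iac
      · simpa [real_inner_comm] using iab
      · simpa using ibc
      · simpa [real_inner_comm] using iac
      · simpa [real_inner_comm] using ibc
  have h0 := Fintype.linearIndependent_iff.1 hli v (by simpa [Fin.sum_univ_three] using hrel)
  exact hv (funext h0)

/-- **Rigidity of volume-preserving isometries.**  Two linear isometries of `ℝ³` which preserve
signed volumes and agree on two touching unit vectors agree everywhere: their quotient fixes a
plane pointwise, maps the normal line to itself, and preserves orientation. [folklore] -/
theorem eq_of_eq_on_pair_of_det {F G : EuclideanSpace ℝ (Fin 3) →ₗᵢ[ℝ] EuclideanSpace ℝ (Fin 3)}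
    {a b : EuclideanSpace ℝ (Fin 3)} (ha : ‖a‖ = 1) (hb : ‖b‖ = 1) (hab : dist a b = 1)
    (h1 : F a = G a) (h2 : F b = G b)
    (dF : ∀ x y z : EuclideanSpace ℝ (Fin 3),
      Matrix.det ![WithLp.ofLp (F x), WithLp.ofLp (F y), WithLp.ofLp (F z)] =
        Matrix.det ![WithLp.ofLp x, WithLp.ofLp y, WithLp.ofLp z])
    (dG : ∀ x y z : EuclideanSpace ℝ (Fin 3),
      Matrix.det ![WithLp.ofLp (G x), WithLp.ofLp (G y), WithLp.ofLp (G z)] =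
        Matrix.det ![WithLp.ofLp x, WithLp.ofLp y, WithLp.ofLp z]) :
    ∀ z, F z = G z := by
  set Ge : EuclideanSpace ℝ (Fin 3) ≃ₗᵢ[ℝ] EuclideanSpace ℝ (Fin 3) := G.toLinearIsometryEquiv rfl
    with hGe
  have hGe_apply : ∀ x, Ge x = G x := fun x => rfl
  set H : EuclideanSpace ℝ (Fin 3) →ₗᵢ[ℝ] EuclideanSpace ℝ (Fin 3) :=
    Ge.symm.toLinearIsometry.comp F with hH
  have hH_apply : ∀ x, H x = Ge.symm (F x) := fun x => rfl
  have Ha : H a = a := by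
    rw [hH_apply]; apply Ge.injective; rw [LinearIsometryEquiv.apply_symm_apply, hGe_apply, h1]
  have Hb : H b = b := by
    rw [hH_apply]; apply Ge.injective; rw [LinearIsometryEquiv.apply_symm_apply, hGe_apply, h2]
  have dH : ∀ x y z : EuclideanSpace ℝ (Fin 3),
      Matrix.det ![WithLp.ofLp (H x), WithLp.ofLp (H y), WithLp.ofLp (H z)] =
        Matrix.det ![WithLp.ofLp x, WithLp.ofLp y, WithLp.ofLp z] := by
    intro x y z
    rw [← dF x y z, ← dG (H x) (H y) (H z)]
    simp only [hH_apply, ← hGe_apply, LinearIsometryEquiv.apply_symm_apply]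
  -- a vector outside the plane of `a, b`
  have hspan : Submodule.span ℝ (Set.range ![a, b]) ≠ ⊤ := by
    intro htop
    have h3 : Module.finrank ℝ (EuclideanSpace ℝ (Fin 3)) = 3 := by simp
    have hle : Module.finrank ℝ (Submodule.span ℝ (Set.range ![a, b])) ≤ 2 := by
      refine (finrank_span_le_card (Set.range ![a, b])).trans ?_
      rw [Set.toFinset_range]
      exact (Finset.card_image_le).trans (by simp)
    rw [htop, finrank_top, h3] at hle
    omega
  obtain ⟨w, -, hw⟩ := SetLike.exists_of_lt (lt_top_iff_ne_top.2 hspan)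
  -- `H w - w` is orthogonal to `a, b` and lies in their plane, hence vanishes
  have iab := inner_eq_half_of_dist_eq_one ha hb hab
  have iaa : ⟪a, a⟫ = 1 := by rw [real_inner_self_eq_norm_sq, ha]; norm_num
  have ibb : ⟪b, b⟫ = 1 := by rw [real_inner_self_eq_norm_sq, hb]; norm_num
  have ma : ⟪H w - w, a⟫ = 0 := by
    rw [inner_sub_left, ← Ha, LinearIsometry.inner_map_map, Ha, sub_self]
  have mb : ⟪H w - w, b⟫ = 0 := by
    rw [inner_sub_left, ← Hb, LinearIsometry.inner_map_map, Hb, sub_self]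
  have hdet : Matrix.det ![WithLp.ofLp a, WithLp.ofLp b, WithLp.ofLp (H w - w)] = 0 := by
    have h := dH a b w
    rw [Ha, Hb] at h
    have expand : Matrix.det ![WithLp.ofLp a, WithLp.ofLp b, WithLp.ofLp (H w - w)] =
        Matrix.det ![WithLp.ofLp a, WithLp.ofLp b, WithLp.ofLp (H w)] -
          Matrix.det ![WithLp.ofLp a, WithLp.ofLp b, WithLp.ofLp w] := by
      simp only [Matrix.det_fin_three]
      simp
      ring
    rw [expand, h, sub_self]
  obtain ⟨v, hv, hrel⟩ := exists_rel_of_det_eq_zero hdet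
  have hv2 : v 2 ≠ 0 := by
    intro hv2
    rw [hv2, zero_smul, add_zero] at hrel
    obtain ⟨h0, h1'⟩ := LinearIndependent.pair_iff.1
      (linearIndependent_pair_of_dist_eq_one ha hb hab) (v 0) (v 1) hrel
    apply hv
    ext i; fin_cases i <;> simp [h0, h1', hv2]
  have hm : H w - w = 0 := by
    have e1 := congrArg (fun z => ⟪z, a⟫) hrel
    have e2 := congrArg (fun z => ⟪z, b⟫) hrel
    simp only [inner_add_left, real_inner_smul_left, iaa, ibb, iab, real_inner_comm a b, ma, mb,
      inner_zero_left] at e1 e2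
    have h0 : v 0 = 0 := by linarith
    have h1' : v 1 = 0 := by linarith
    rw [h0, h1', zero_smul, zero_smul, zero_add, zero_add] at hrel
    exact (smul_eq_zero.1 hrel).resolve_left hv2
  have Hw : H w = w := sub_eq_zero.1 hm
  -- `H` fixes a basis, so `H = id`
  have hli : LinearIndependent ℝ ![w, a, b] :=
    linearIndependent_finCons.2 ⟨linearIndependent_pair_of_dist_eq_one ha hb hab, hw⟩
  have hspan3 := hli.span_eq_top_of_card_eq_finrank (by simp)
  have key : H.toLinearMap = LinearMap.id := by
    refine LinearMap.ext_on_range hspan3 fun i => ?_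
    fin_cases i
    · simpa using Hw
    · simpa using Ha
    · simpa using Hb
  intro z
  have hz : H z = z := by simpa using congrArg (fun T => T z) key
  rw [hH_apply] at hz
  have := congrArg Ge hz
  rwa [LinearIsometryEquiv.apply_symm_apply, hGe_apply] at this

/-! ### Oriented transition isometries -/

/-- **Oriented transition lemma.**  Let `j ~ k` be bonded charted sites (`nn_j > 0`) whose charts
give every contact tetrahedron `{j, k, a, b}` through the bond the same handedness: the signed
volumes of the label triples `(ℓ_j k, ℓ_j a, ℓ_j b)` and `(ℓ_k j, ℓ_k a, ℓ_k b)` are opposite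
(as they are for the true relative positions).  Then the transition isometry `L` of
`shadow_transition` (`L ℓ_j k = −ℓ_k j`, `L ℓ_j s = ℓ_k s − ℓ_k j` on common neighbours `s`)
preserves signed volumes: it carries the label triple of one contact tetrahedron through the
bond (`pattern_star_edge`) to a triple of the same non-zero volume. [folklore] -/
theorem develop_transition_oriented {η : ℝ} {N : ℕ} {y : Fin N → EuclideanSpace ℝ (Fin 3)}
    {Pc : Fin N → Finset (EuclideanSpace ℝ (Fin 3))} {Ac : Fin N → EuclideanSpace ℝ (Fin 3) →ₗᵢ[ℝ] EuclideanSpace ℝ (Fin 3)}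
    {mc : Fin N → EuclideanSpace ℝ (Fin 3) → Fin N} {j k : Fin N}
    (hj : ((Pc j = fccKissingPattern ∨ Pc j = hcpKissingPattern) ∧ (∀ p ∈ Pc j, (bondGraph η y).Adj j (mc j p) ∧ dist (y (mc j p)) (y j + nearestDist y j • Ac j p) ≤ nearestDist y j / 4) ∧ (∀ p ∈ Pc j, ∀ q ∈ Pc j, mc j p = mc j q → p = q) ∧ (∀ p ∈ Pc j, ∀ q ∈ Pc j, ((bondGraph η y).Adj (mc j p) (mc j q) ↔ dist p q = 1)) ∧ (∀ l, (bondGraph η y).Adj j l → ∃ p ∈ Pc j, mc j p = l)))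
    (hk : ((Pc k = fccKissingPattern ∨ Pc k = hcpKissingPattern) ∧ (∀ p ∈ Pc k, (bondGraph η y).Adj k (mc k p) ∧ dist (y (mc k p)) (y k + nearestDist y k • Ac k p) ≤ nearestDist y k / 4) ∧ (∀ p ∈ Pc k, ∀ q ∈ Pc k, mc k p = mc k q → p = q) ∧ (∀ p ∈ Pc k, ∀ q ∈ Pc k, ((bondGraph η y).Adj (mc k p) (mc k q) ↔ dist p q = 1)) ∧ (∀ l, (bondGraph η y).Adj k l → ∃ p ∈ Pc k, mc k p = l)))
    (hν : 0 < nearestDist y j) (hjk : (bondGraph η y).Adj j k)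
    (hO : (∀ a b : Fin N, (bondGraph η y).Adj j a → (bondGraph η y).Adj j b → (bondGraph η y).Adj k a → (bondGraph η y).Adj k b → (bondGraph η y).Adj a b → ∀ p₁ ∈ Pc j, ∀ p₂ ∈ Pc j, ∀ p₃ ∈ Pc j, mc j p₁ = k → mc j p₂ = a → mc j p₃ = b → ∀ q₁ ∈ Pc k, ∀ q₂ ∈ Pc k, ∀ q₃ ∈ Pc k, mc k q₁ = j → mc k q₂ = a → mc k q₃ = b → Matrix.det ![WithLp.ofLp p₁, WithLp.ofLp p₂, WithLp.ofLp p₃] = - Matrix.det ![WithLp.ofLp q₁, WithLp.ofLp q₂, WithLp.ofLp q₃])) :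
    ∃ L : EuclideanSpace ℝ (Fin 3) →ₗᵢ[ℝ] EuclideanSpace ℝ (Fin 3),
      (∀ p ∈ Pc j, ∀ p' ∈ Pc k, mc j p = k → mc k p' = j → L p = -p' ∧
        ∀ q ∈ Pc j, ∀ q' ∈ Pc k, mc j q = mc k q' → L q = q' - p') ∧
      ∀ x y z : EuclideanSpace ℝ (Fin 3), Matrix.det ![WithLp.ofLp (L x), WithLp.ofLp (L y), WithLp.ofLp (L z)] = Matrix.det ![WithLp.ofLp x, WithLp.ofLp y, WithLp.ofLp z] := by
  obtain ⟨hP, C2, C3, C4, C5⟩ := hj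
  obtain ⟨hP', C2', C3', C4', C5'⟩ := hk
  obtain ⟨L, hL⟩ := shadow_transition η N y j k hν hjk (Pc j) (Ac j) (mc j) hP C2 C3 C4 C5
    (Pc k) (Ac k) (mc k) hP' C2' C3' C4' C5'
  refine ⟨L, hL, ?_⟩
  -- the labels of the bond and a contact tetrahedron through it
  obtain ⟨p₀, hp₀, hp₀k⟩ := C5 k hjk
  obtain ⟨p₀', hp₀', hp₀'j⟩ := C5' j hjk.symm
  obtain ⟨hL0, hLq⟩ := hL p₀ hp₀ p₀' hp₀' hp₀k hp₀'j
  obtain ⟨pa, hpa, pb, hpb, h0a, h0b, hab⟩ := pattern_star_edge (Pc j) hP p₀ hp₀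
  have hka : (bondGraph η y).Adj k (mc j pa) := by rw [← hp₀k]; exact (C4 p₀ hp₀ pa hpa).2 h0a
  have hkb : (bondGraph η y).Adj k (mc j pb) := by rw [← hp₀k]; exact (C4 p₀ hp₀ pb hpb).2 h0b
  have hab' : (bondGraph η y).Adj (mc j pa) (mc j pb) := (C4 pa hpa pb hpb).2 hab
  obtain ⟨qa, hqa, hqa'⟩ := C5' _ hka
  obtain ⟨qb, hqb, hqb'⟩ := C5' _ hkb
  have hdet := hO (mc j pa) (mc j pb) (C2 pa hpa).1 (C2 pb hpb).1 hka hkb hab' p₀ hp₀ pa hpa pb hpb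
    hp₀k rfl rfl p₀' hp₀' qa hqa qb hqb hp₀'j hqa' hqb'
  have hLa : L pa = qa - p₀' := hLq pa hpa qa hqa hqa'.symm
  have hLb : L pb = qb - p₀' := hLq pb hpb qb hqb hqb'.symm
  -- the volume of the image triple
  have himg : Matrix.det ![WithLp.ofLp (L p₀), WithLp.ofLp (L pa), WithLp.ofLp (L pb)] = Matrix.det ![WithLp.ofLp p₀, WithLp.ofLp pa, WithLp.ofLp pb] := by
    rw [hdet, hL0, hLa, hLb]
    simp only [Matrix.det_fin_three]
    simp
    ring
  obtain ⟨δ, hδ⟩ := exists_det_map_eq_mul L.toLinearMap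
  have hne := det_ne_zero_of_unit_triangle (norm_eq_one_of_mem_pattern hP hp₀)
    (norm_eq_one_of_mem_pattern hP hpa) (norm_eq_one_of_mem_pattern hP hpb) h0a h0b hab
  have hδ1 : δ = 1 := by
    have h := hδ p₀ pa pb
    simp only [LinearIsometry.coe_toLinearMap] at h
    rw [himg] at h
    field_simp at h
    linarith [h]
  intro x y z
  have h := hδ x y z
  simp only [LinearIsometry.coe_toLinearMap] at h
  rw [h, hδ1, one_mul]

/-! ### The triangle rule -/

/-- **Registered sub-goal `develop_triangle`** of the crux item (TRIANGLE RULE of the development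
of the shadow crystal).  Let `c ~ u ~ t ~ c` be a bond triangle of charted sites (charts as
functions `Pc, Ac, mc` of the site, `nn_c, nn_u > 0`), whose three bonds satisfy the handedness
hypothesis (every contact tetrahedron through the bond is given the same handedness by the charts
at its two ends), and let `D, Q` be frames.  If the frames are compatible along `(c, u)` and along
`(c, t)` (the developments of the two stars agree on the common sites), they are compatible along
`(u, t)`.  By the frame equation this is the cocycle identity `L_ct = L_ut ∘ L_cu` of the oriented
transition isometries, which agree on the labels of `u` and `t` at `c` and preserve signed
volumes. [folklore] -/
theorem develop_triangle :  ∀ (η : ℝ) (N : ℕ) (y : Fin N → EuclideanSpace ℝ (Fin 3)) (Pc : Fin N → Finset (EuclideanSpace ℝ (Fin 3))) (Ac : Fin N → EuclideanSpace ℝ (Fin 3) →ₗᵢ[ℝ] EuclideanSpace ℝ (Fin 3)) (mc : Fin N → EuclideanSpace ℝ (Fin 3) → Fin N) (c u t : Fin N),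
    (∀ v : Fin N, (v = c ∨ v = u ∨ v = t) →
      ((Pc v = Literature.Geometry.DiscreteGeometry.fccKissingPattern ∨ Pc v = Literature.Geometry.DiscreteGeometry.hcpKissingPattern) ∧ (∀ p ∈ Pc v, (Literature.Geometry.DiscreteGeometry.bondGraph η y).Adj v (mc v p) ∧ dist (y (mc v p)) (y v + Literature.Geometry.DiscreteGeometry.nearestDist y v • Ac v p) ≤ Literature.Geometry.DiscreteGeometry.nearestDist y v / 4) ∧ (∀ p ∈ Pc v, ∀ q ∈ Pc v, mc v p = mc v q → p = q) ∧ (∀ p ∈ Pc v, ∀ q ∈ Pc v, ((Literature.Geometry.DiscreteGeometry.bondGraph η y).Adj (mc v p) (mc v q) ↔ dist p q = 1)) ∧ (∀ l, (Literature.Geometry.DiscreteGeometry.bondGraph η y).Adj v l → ∃ p ∈ Pc v, mc v p = l))) →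
    0 < Literature.Geometry.DiscreteGeometry.nearestDist y c → 0 < Literature.Geometry.DiscreteGeometry.nearestDist y u →
    (Literature.Geometry.DiscreteGeometry.bondGraph η y).Adj c u → (Literature.Geometry.DiscreteGeometry.bondGraph η y).Adj c t → (Literature.Geometry.DiscreteGeometry.bondGraph η y).Adj u t →
    (∀ j k : Fin N, ((j = c ∧ k = u) ∨ (j = c ∧ k = t) ∨ (j = u ∧ k = t)) →
      (∀ a b : Fin N, (Literature.Geometry.DiscreteGeometry.bondGraph η y).Adj j a → (Literature.Geometry.DiscreteGeometry.bondGraph η y).Adj j b → (Literature.Geometry.DiscreteGeometry.bondGraph η y).Adj k a → (Literature.Geometry.DiscreteGeometry.bondGraph η y).Adj k b → (Literature.Geometry.DiscreteGeometry.bondGraph η y).Adj a b → ∀ p₁ ∈ Pc j, ∀ p₂ ∈ Pc j, ∀ p₃ ∈ Pc j, mc j p₁ = k → mc j p₂ = a → mc j p₃ = b → ∀ q₁ ∈ Pc k, ∀ q₂ ∈ Pc k, ∀ q₃ ∈ Pc k, mc k q₁ = j → mc k q₂ = a → mc k q₃ = b → Matrix.det ![WithLp.ofLp p₁, WithLp.ofLp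 p₂, WithLp.ofLp p₃] = - Matrix.det ![WithLp.ofLp q₁, WithLp.ofLp q₂, WithLp.ofLp q₃])) →
    ∀ (D : Fin N → EuclideanSpace ℝ (Fin 3)) (Q : Fin N → EuclideanSpace ℝ (Fin 3) →ₗᵢ[ℝ] EuclideanSpace ℝ (Fin 3)),
    ((∀ p ∈ Pc c, ∀ p' ∈ Pc u, mc c p = mc u p' → D c + Q c p = D u + Q u p') ∧ (∀ p ∈ Pc c, mc c p = u → D c + Q c p = D u) ∧ (∀ p' ∈ Pc u, mc u p' = c → D u + Q u p' = D c)) →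
    ((∀ p ∈ Pc c, ∀ p' ∈ Pc t, mc c p = mc t p' → D c + Q c p = D t + Q t p') ∧ (∀ p ∈ Pc c, mc c p = t → D c + Q c p = D t) ∧ (∀ p' ∈ Pc t, mc t p' = c → D t + Q t p' = D c)) →
    ((∀ p ∈ Pc u, ∀ p' ∈ Pc t, mc u p = mc t p' → D u + Q u p = D t + Q t p') ∧ (∀ p ∈ Pc u, mc u p = t → D u + Q u p = D t) ∧ (∀ p' ∈ Pc t, mc t p' = u → D t + Q t p' = D u)) := by
  intro η N y Pc Ac mc c u t hch hνc hνu hcu hct hut hO D Q Ccu Cct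
  have hc := hch c (Or.inl rfl)
  have hu := hch u (Or.inr (Or.inl rfl))
  have ht := hch t (Or.inr (Or.inr rfl))
  have hOcu := hO c u (Or.inl ⟨rfl, rfl⟩)
  have hOct := hO c t (Or.inr (Or.inl ⟨rfl, rfl⟩))
  have hOut := hO u t (Or.inr (Or.inr ⟨rfl, rfl⟩))
  -- the three oriented transition isometries
  obtain ⟨L1, hL1, dL1⟩ := develop_transition_oriented hc hu hνc hcu hOcu
  obtain ⟨L2, hL2, dL2⟩ := develop_transition_oriented hc ht hνc hct hOct
  obtain ⟨L3, hL3, dL3⟩ := develop_transition_oriented hu ht hνu hut hOut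
  obtain ⟨hPc, Cc2, Cc3, Cc4, Cc5⟩ := hc
  obtain ⟨hPu, Cu2, Cu3, Cu4, Cu5⟩ := hu
  obtain ⟨hPt, Ct2, Ct3, Ct4, Ct5⟩ := ht
  -- labels: `e1 = ℓ_c u`, `e2 = ℓ_c t`, `g1 = ℓ_u c`, `f = ℓ_u t`, `g2 = ℓ_t c`, `f' = ℓ_t u`
  obtain ⟨e1, he1, he1u⟩ := Cc5 u hcu
  obtain ⟨e2, he2, he2t⟩ := Cc5 t hct
  obtain ⟨g1, hg1, hg1c⟩ := Cu5 c hcu.symm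
  obtain ⟨f, hf, hft⟩ := Cu5 t hut
  obtain ⟨g2, hg2, hg2c⟩ := Ct5 c hct.symm
  obtain ⟨f', hf', hf'u⟩ := Ct5 u hut.symm
  obtain ⟨hL1e, hL1q⟩ := hL1 e1 he1 g1 hg1 he1u hg1c
  obtain ⟨hL2e, hL2q⟩ := hL2 e2 he2 g2 hg2 he2t hg2c
  obtain ⟨hL3f, hL3q⟩ := hL3 f hf f' hf' hft hf'u
  -- values on the mixed labels (`t` is common to `c, u`; `u` to `c, t`; `c` to `u, t`)
  have L1e2 : L1 e2 = f - g1 := hL1q e2 he2 f hf (he2t.trans hft.symm)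
  have L2e1 : L2 e1 = f' - g2 := hL2q e1 he1 f' hf' (he1u.trans hf'u.symm)
  have L3g1 : L3 g1 = g2 - f' := hL3q g1 hg1 g2 hg2 (hg1c.trans hg2c.symm)
  -- the frame equations along `(c, u)` and `(c, t)`
  obtain ⟨hQ1, hDu⟩ := develop_frame_eq (j := c) (k := u) hPc Cc4 Cu5 he1 he1u hg1 hg1c hL1e hL1q
    Ccu.1 Ccu.2.1 Ccu.2.2
  obtain ⟨hQ2, hDt⟩ := develop_frame_eq (j := c) (k := t) hPc Cc4 Ct5 he2 he2t hg2 hg2c hL2e hL2q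
    Cct.1 Cct.2.1 Cct.2.2
  -- the cocycle identity `L2 = L3 ∘ L1`
  have cocycle : ∀ z, L2 z = (L3.comp L1) z := by
    refine eq_of_eq_on_pair_of_det (norm_eq_one_of_mem_pattern hPc he1)
      (norm_eq_one_of_mem_pattern hPc he2) ?_ ?_ ?_ dL2 ?_
    · rw [← Cc4 e1 he1 e2 he2, he1u, he2t]; exact hut
    · rw [LinearIsometry.coe_comp, Function.comp_apply, hL1e, map_neg, L3g1, L2e1]; abel
    · rw [LinearIsometry.coe_comp, Function.comp_apply, L1e2, map_sub, hL3f, L3g1, hL2e]; abel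
    · intro x y z
      rw [LinearIsometry.coe_comp, Function.comp_apply, Function.comp_apply, Function.comp_apply,
        dL3, dL1]
  -- consequences: `Q u = Q t ∘ L3` and `D t = D u + Q u f`
  have hQ3 : ∀ z, Q u z = Q t (L3 z) := by
    intro z
    -- `L1` is onto: write `z = L1 w`
    obtain ⟨w, rfl⟩ := (L1.toLinearIsometryEquiv rfl).surjective z
    rw [LinearIsometry.coe_toLinearIsometryEquiv, ← hQ1 w, hQ2 w, cocycle w,
      LinearIsometry.coe_comp, Function.comp_apply]
  have hDt' : D t = D u + Q u f := by
    have hf : f = L1 (e2 - e1) := by rw [map_sub, L1e2, hL1e]; abel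
    rw [hDt, hDu, hf, ← hQ1, map_sub]; abel
  -- compatibility along `(u, t)`
  refine ⟨?_, ?_, ?_⟩
  · intro q hq q' hq' hqq'
    rw [hDt', hQ3 q, hL3q q hq q' hq' hqq', map_sub, hQ3 f, hL3f, map_neg]
    abel
  · intro p hp hpt
    obtain rfl : p = f := Cu3 p hp f hf (hpt.trans hft.symm)
    exact hDt'.symm
  · intro p' hp' hp'u
    obtain rfl : p' = f' := Ct3 p' hp' f' hf' (hp'u.trans hf'u.symm)
    rw [hDt', hQ3 f, hL3f, map_neg]
    abel

end Summit.AtomisticToContinuum.Crystallization.Theorems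

end
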